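import Mathlib
import HarnessLib
import HarnessLib.Audit
import Summits.PneNP.Statement
import Literature.Computability.Complexity.CNF
import Literature.Computability.Complexity.RandomCNF
import Literature.Computability.Complexity.Randomized
import Literature.Computability.Complexity.ProbabilisticClasses
import Literature.Computability.Complexity.Nondeterministic
import HarnessLib.Audit.Status.Attr

/-!
Route: WitnessForging

DORMANT since 2026-08-23T06:27:28Z (reconciler: no traction for 5.9 d (last activity statement-grounded at 2026-08-17T07:13:24Z); parked, not closed — `ledger route dormant route-PneNP-WitnessForging --off` to reactivate) — unstaffed, not closed; items shared with open routes are served there. `ledger route dormant <id> --off` reactivates.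

# Route PneNP/WitnessForging — "solved puzzles cannot be forged": P ≠ NP as non-samplability of
NP-witness measures, climbed through sampler classes (idea card
PneNP/PneNP/witness-measure-forging-ladder)

## Thesis X (it suffices to show) — the witness-forging hypothesis
Words: no probabilistic polynomial-time algorithm, given a satisfiable CNF φ, outputs a satisfying
assignment whose law is within total-variation distance 1/4 of the UNIFORM measure μ_φ on the
satisfying assignments of φ (assignments = bit strings of length numVars φ; φ compactly indexed,
numVars φ ≤ |enc φ|). Formally: every PPT `A : RandAlg {0,1}* {0,1}*` admits a satisfiable compact φ
and an event E with |Pr[A(enc φ) ∈ E] − μ_φ(E)| > 1/4.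
Lean: `ForgingThesis` (decl of this file; over `Literature.Computability.Complexity.RandAlg` / `.pr`
/ `.IsPolyTime`, `CNF.eval` / `.numVars` / `.Satisfiable`, `encodingCNF`, `Set.ncard`; elaborates,
planner Sketch rc = 0).
Calibration: NP ⊄ BPP ⇒ X (a 1/4-forger decides SAT with one-sided error: `CalibrationSatBPP`) and X
⇒ P ≠ NP (assembly); with `SatBridge`, X ⇔ NP ⊄ BPP. X is a REFORMULATION whose object is a
pushforward measure μ_φ rather than a truth table; the content of the route is the ladder of rung
statements "no sampler of class 𝒞 forges μ_Φ" for Φ random k-SAT in the shattered window, typed over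
the tree's `randomKCNF`.

## Assembly X → PneNP (deciding theorem `closes`)
`theorem closes : ForgingThesis → SatBridge → ClassBridge → PneNP` (in this file; 14 lines, axioms
propext / Classical.choice / Quot.sound): if ¬PneNP then every Cook-NP language is Cook-P
(`PNPWave0.NP Bool ⊆ PNPWave0.P Bool`); the support item `ClassBridge` (model bridge Wave0 classes →
prelude classes, provable now in three lines from the tree theorems `P_bool_eq_holds`,
`NP_bool_eq_holds`, `P_subset_BPP_holds`) turns this into `Nondeterministic.NP ⊆ BPP`; `SatBridge` —
Jerrum–Valiant–Vazirani / Bellare–Goldreich–Petrank uniform generation with an NP oracle, made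
oracle-free by NP ⊆ BPP; Stockmeyer's approximate counting is already the tree theorem
`stockmeyerApproxCounting_holds` — at the constant polynomial s = 3 gives a PPT forger within
1/(3+1) = 1/4 of μ_φ on every satisfiable compact φ, contradicting X (`ForgingThesis`). The bridges
are consumed through the ITEM `ClassBridge` instead of `import …Complexity.ClayProblem`, so the
route's import cone no longer contains the open conjecture `NPNotSubsetPPoly` (the one unproved cone
fact that kept the route unstaffed); the item `Assembly` is restated 1:1 over listed items as
`SatBridge → ClassBridge → ForgingThesis → PneNP` (stmt-PneNP-10554; it follows from `closes` in one
line, candidate proof attached as evidence), superseding the rev-1 signature SatBridge →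
P_subset_BPP → P_bool_eq → NP_bool_eq → ForgingThesis → PneNP (stmt-PneNP-2431, retired) whose
middle hypotheses were unlisted Literature facts.

Rationale: WHY THIS LINE (widen: complexity of DISTRIBUTIONS + random structures + spin-glass geometry). P = NP
would make a uniformly random SOLVED puzzle as cheap to forge as a random puzzle: witness sampling ≡
approximate counting ≡ BPP^NP (JerrumValiantVazirani1986; BGP doi:10.1006/inco.2000.2885;
Stockmeyer1985, in tree as `stockmeyerApproxCounting_holds`), so unforgeability of NP-witness
measures implies P ≠ NP with no loss beyond NP-vs-BPP. Trading the truth table SAT for the measures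
μ_φ buys lower-bound technology that decision problems do not have: local / AC⁰ sources cannot
sample codes or slices (Viola doi:10.1137/100814998; Lovett–Viola doi:10.1007/s00037-012-0039-3;
Viola doi:10.4230/lipics.ccc.2023.26; Kane–Ostuni–Wu doi:10.1145/3618260.3649670,
doi:10.1145/3717823.3718243), stable algorithms cannot sample shattered Gibbs measures (El
Alaoui–Montanari–Sellke doi:10.1109/focs54457.2022.00038; El Alaoui–Gamarnik doi:10.1002/rsa.70021),
low-degree polynomials stall at the clustering threshold of random k-SAT search (Bresler–Huang
doi:10.1109/focs52979.2021.00038), and shattering of the random k-SAT solution space in (1+ε_k)2^k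
ln k/k ≤ α ≤ (1−ε_k)2^k ln 2 is a theorem (Achlioptas–Coja-Oghlan doi:10.1109/focs.2008.11). Each
becomes a RUNG "no sampler of class 𝒞 1/3-forges μ_Φ", Φ ∼ randomKCNF k n ⌊αn⌋ (in tree), none
implied by a decision lower bound (weak samplers cannot even evaluate a CNF). Imported: pushforward
measures / TV over events (probability), F₂-polynomial maps (algebra), Efron–Stein concentration
(local rung). Cross-summit: the Stockmeyer/sampling-hardness template is the one driving
QuantumAdvantage (AaronsonArkhipovToC2013), whose vendored Stockmeyer fact this route reuses.
RANKED CRUXES. #2 `SatBridge`: NP ⊆ BPP ⇒ for every polynomial s a PPT algorithm whose output on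
every satisfiable compact φ is within TV 1/(s(|enc φ|)+1) of μ_φ — a known theorem ranked first by
plancard policy because the deciding theorem `closes` rests on it and it is not in the tree
(infrastructure: `exists_randSearch_of_NP_subset_BPP`, `AffineHashing`, `StockmeyerMachines`;
book:miklos2019-computational-complexity-counting-sampling Thm 81). #3 `LowDegreeRung` (new): for
every d, k ≥ k₀(d), 5·2^k ln k/k ≤ α ≤ 2^{k−1}: Pr_Φ[Φ satisfiable ∧ some degree-≤d F₂-polynomial
map of random coins 1/3-forges μ_Φ] → 0 — the XORSAT-immune rung (affine maps DO forge XORSAT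
exactly: `AffineWitnessesForgeable`), degree in the COINS with Φ hard-wired (not Bresler–Huang's
degree in Φ). #4 `ShatteredForgingHard`: same window, no PPT algorithm 1/4-forges μ_Φ except with
vanishing probability over Φ — thesis strength on the canonical ensemble, above the search barrier
κ*·2^k ln k/k (κ* ≈ 4.91) hence implied by the standard search-hardness conjecture; with
Achlioptas–Peres doi:10.1090/s0894-0347-04-00464-3 (Φ satisfiable w.h.p.) it implies X.
SUPPORT (typed, provable now). `LocalSamplersMissShatteredSets`: ℓ-local maps cannot 1/3-forge the
uniform measure on ANY δn-separated clustering whose clusters have relative mass ≤ e^{−εn}, n ≥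
n₀(ℓ,δ,ε) — proof sketch: ≤ ℓ/γ coins have fan-out ≥ γn; condition on them; in each branch
Efron–Stein + Chebyshev on d(out,W_J) − d(out,W_{J^c}) forces one cluster to carry all but 4γℓ/δ² of
the in-S mass; ≤ 2^{ℓ/γ} clusters then carry ≥ 1/2 against μ ≤ 2^{ℓ/γ}e^{−εn} (the discrete twin of
the EAMS stability argument; with ACO08 it is the NC⁰ rung on random k-SAT).
`AffineWitnessesForgeable` (sanity floor of the ladder). `CalibrationSatBPP` (SAT ∉ BPP ⇒ X).
`ClassBridge` (model bridge, provable now: `PNPWave0.NP Bool ⊆ PNPWave0.P Bool → Nondeterministic.NP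
⊆ BPP` from `P_bool_eq_holds` / `NP_bool_eq_holds` / `P_subset_BPP_holds`; filed as an ITEM so the
route file need not import `…Complexity.ClayProblem`, whose open conjecture `NPNotSubsetPPoly` was
the one unproved fact in the import cone). Deciding theorem `closes : ForgingThesis → SatBridge →
ClassBridge → PneNP` proved in the route file; the `Assembly` item, restated as `SatBridge →
ClassBridge → ForgingThesis → PneNP`, follows from it in one line (candidate proofs for `Assembly`
and `ClassBridge` attached as evidence).
KILL CRITERIA. An explicit PPT sampler inside the window refutes `ShatteredForgingHard` ⇒ restate on
the frozen regime α ≥ (1−ε)2^k ln 2 or close; an algebraic (fixed-degree) forger of shattered random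
k-SAT refutes `LowDegreeRung` ⇒ no XORSAT-immune algebraic rung exists, close as refuted; a proof
that the rung techniques localise to samplers with small-fan-in oracle gates (CHOPRS) ⇒ dormant;
rigorous samplers currently reach only α ≈ 2^{k/3} (doi:10.1137/1.9781611977554.ch128,
doi:10.1137/20m1351527, doi:10.1137/23m1595722).
DELIBERATELY NOT DECOMPOSED: the card's planted ensemble X_D (needs `plantedKCNF`; quiet vs naive
planting; X_D ⇒ OWF per audit, so NOT "the weakest average-case statement"); the stable/W₂ and
Glauber rungs (transport stability not in Mathlib); AC⁰ forgers; the non-uniform dictionary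
(poly-size forging circuits ⇔ NPNotSubsetPPoly, route Circuit); the glue items `ShatteredForgingHard
∧ AP04 → ForgingThesis` and `LocalSamplersMissShatteredSets ∧ ACO08-shattering → NC⁰ rung on random
k-SAT` (filed when a crux closes); Ding–Sly–Sun doi:10.4007/annals.2022.196.1.1 only matters if the
window is pushed to α_sat.

CHEAPEST FALSIFIER. Read off the density reached by the newest rigorous samplers/approximate
counters for random k-SAT (2^k/poly(k): doi:10.1145/3717823.3718163 and its successors; algorithmic
search stops at (1−o(1))2^k ln k/k, doi:10.1109/focs.2008.11): any PPT sampler whose output law is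
within TV 1/4 of μ_Φ at a density α ≥ 5·2^k ln k/k for all large k kills `ShatteredForgingHard` as
stated (kill criterion 1) — a constants check in two papers, no computation; for `LowDegreeRung` the
cheapest kill is a degree-2 forger of a shattered non-affine ensemble (d = 1 already forges XORSAT,
`AffineWitnessesForgeable`).

Novelty: Delta: new COMBINATION (card audit grade: new-combination) — [JVV/Stockmeyer bridge, formal,
Stockmeyer half already a tree theorem] ⊕ [class-restricted sampling lower bounds] ⊕ [shattering of
random k-SAT], with one new concrete rung and one transplanted lemma; no new top-rung mechanism is
claimed (X ⇔ NP ⊄ BPP). NOT found in print: (i) instance-indexed forging lower bounds for NP-witness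
measures organised as a ladder under a P≠NP thesis; (ii) `LowDegreeRung` — degree-d F₂ maps (degree
in the COINS, formula hard-wired; not Bresler–Huang's degree in the formula,
doi:10.1109/focs52979.2021.00038) vs the uniform measure on random k-SAT solutions in the shattered
window; (iii) the class-free lemma `LocalSamplersMissShatteredSets` (shattering alone defeats
ℓ-local samplers), a discrete Efron–Stein transplant of the stability argument of El
Alaoui–Montanari–Sellke doi:10.1109/focs54457.2022.00038 / El Alaoui–Gamarnik doi:10.1002/rsa.70021.
Nearest prior art actually found (searched 2026-08-15: `lit search --source crossref|zbmath` ×14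
queries — local searchd down, OpenAlex/S2/arXiv rate-limited —, `lit frontier PneNP --since 2020`,
`lit bridges PneNP --cross any`, held book:miklos2019-computational-complexity-counting-sampling Thm
81 pp. 282–286): bridge = JerrumValiantVazirani1986 + Bellare–Goldreich–Petrank
doi:10.1006/inco.2000.2885 + Stockmeyer1985 ("PPT forger ⇔ NP ⊆ BPP" is folklore from these); rung
template = Viola's complexity of distributions doi:10.1137/100814998, Love  [refs: 10.1109/focs52979.2021.00038, 10.1109/focs54457.2022.00038, 10.1002/rsa.70021., 10.1006/inco.2000.2885, 10.1137/100814998, 10.1007/s00037-012-0039-3, 10.4230/lipics.ccc.2023.26, 10.1145/3618260.3649670, 10.1145/3717823.3718243, 10.1109/focs.2008.11, 10.1007/s00037-009-0258-4, 10.1145/2934308, doi:10.1109/focs52979.2021.00038, doi:10.1109/focs54457.2022.00038, doi:10.1002/rsa.70021., book:miklos201]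

Barriers (technique_class: witness-forging-lower-bounds, sampling-lower-bounds): technique_class: witness-forging-lower-bounds, sampling-lower-bounds
- Literature.Barriers.PneNP.Relativization: APPLIES at thesis level — X ⇔ NP ⊄ BPP and the assembly
(JVV / Stockmeyer / forger ⇒ RP) relativizes, so a proof of X must be non-relativizing and the route
has no such argument at the top rung (honest bet: the measure formulation exposes intermediate
sampler classes where theorems are provable and XORSAT is correctly easy). The filed rung statements
(`LowDegreeRung`, `LocalSamplersMissShatteredSets`) concern explicit sampler classes and explicit
measures with no oracle, outside the barrier's `blocks` clause, exactly like AC⁰ sampling bounds.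
- Literature.Barriers.PneNP.Algebrization: same status — binds X (AW list NP ⊆ BPP among the
algebrization-independent inclusions) and the assembly; the sumcheck identity #φ = #φ|₀ + #φ|₁ that
approximate forgers must respect is arithmetization-type and cannot be the engine alone; silent on
the rung cruxes.
- Literature.Barriers.PneNP.NaturalProofs: not met by the filed items — they bound SAMPLER classes
on instance-indexed measures over a non-large family (random k-SAT instances), not
P/poly-constructive large properties of truth tables; it WOULD bind a non-uniform top rung (no
poly-size forging circuits ⇔ NP ⊄ P/poly), deliberately not filed. Audit addendum kept:
`ShatteredForgingHard`-type average-case hardness yields OWF-like objects, so any rung technique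
that scaled to TC⁰ / P/poly forgers would have to be non-naturalisi

Novelty grade: new-combination — ROUTE REVIEW (refuter gen3 2026-08-15; consolidates c064b68f, 9bf55acc, 6bad857d g0-g2; per-item briefings on the items). STATEMENTS: all 8 decls rc0; mu_phi junk-free on satisfiable phi; compactness guard right; Assembly PROVED (evidence x3 on 2431, s:=3); SatBridge rightly support (JVV86 o Stockme (refuter refuter-rreview-route-HubbardSuperconduc-6bad857d-g3-0, 2026-08-15T14:48:47Z; prior: JerrumValiantVazirani1986, doi:10.1006/inco.2000.2885, Stockmeyer1985, doi:10.1137/100814998, doi:10.1007/s00037-012-0039-3, doi:10.1109/focs.2008.11, doi:10.1109/focs54457.2022.00038, doi:10.1109/focs52979.2021.00038, arXiv:2605.00995, doi:10.1145/3618260.3649670, doi:10.1145/3717823.3718163, book:miklos2019-computational-complexity-counting-sampling)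

History (route lifecycle, newest last):
- 2026-08-15T16:18:28Z · rev 2: restated Assembly (stmt-PneNP-2431) — route-repair (glue.missing + glue.extra-hypothesis + cone guardrail): deciding theorem `closes : ForgingThesis → SatBridge → ClassBridge → PneNP` supplied (sorr (planner-rbadge-PneNP-WitnessForging-71e13167-g2-0)
- 2026-08-16T04:14:42Z · AUTO-CRUX (backfill): ForgingThesis — hypotheses of the deciding theorem that nothing in the route derives are cruxes (operator:999:1085951)
- 2026-08-23T06:27:28Z · DORMANT — reconciler: no traction for 5.9 d (last activity statement-grounded at 2026-08-17T07:13:24Z); parked, not closed — `ledger route dormant route-PneNP-WitnessForg (operator:999:3486383)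

sub-problem: PneNP · status: dormant · opened planner-plancard-PneNP-PneNP-witness-measure--f3ec001c-0 2026-08-15T11:04:11Z · rev 4 · ledger route-PneNP-WitnessForging
GENERATED by the gate from the ledger (D-0016/17). Provers cite these decls: `theorem foo : Summit.PneNP.PneNP.Theses.WitnessForging.<Decl> := …` in Summits/PneNP/PneNP/Theorems/<Name>.lean.
-/

namespace Summit.PneNP.PneNP.Theses.WitnessForging

open scoped BigOperators Topology Manifold Classical MeasureTheory ProbabilityTheory Matrix InnerProductSpace ComplexConjugate ContinuousMap
open Filter Set Function TopologicalSpace MeasureTheory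

attribute [summit_statement] _root_.PneNP

open Literature.PNP

/-- item stmt-PneNP-2430 · crux (kind.auto-crux: conjecture-grade) · rank 0 · open · by planner
why it might fail: X ⇔ NP ⊄ BPP (SatBridge gives ⇒, CalibrationSatBPP ⇐): refuted iff SAT ∈ BPP; if true it is hypothesis-strength — any proof must be non-relativizing and non-algebrizing (NP vs BPP is algebrization-independent, AW09 Thms 5.3–5.4) and no filed rung reaches general PPT forgers.
sources: JerrumValiantVazirani1986, doi:10.1006/inco.2000.2885, Goldreich2001FoC1 §2.7.3, Literature.Barriers.PneNP.Relativization, Literature.Barriers.PneNP.Algebrization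
[target] Route thesis X of PneNP/WitnessForging (witness-forging hypothesis): for every
probabilistic polynomial-time A : RandAlg {0,1}* {0,1}* there is a satisfiable, compactly indexed
CNF φ (numVars φ ≤ |enc φ|) and an event E ⊆ {0,1}* with |Pr_coins[A(enc φ) ∈ E] − μ_φ(E)| > 1/4,
where μ_φ is the uniform measure on the satisfying assignments of φ written as bit strings of length
numVars φ (μ_φ(E) = |Sol φ ∩ E| / |Sol φ| via Set.ncard). Equivalently: SAT witnesses are not
almost-uniformly generable in PPT. Calibration: NP ⊄ BPP ⇒ X (CalibrationSatBPP) and X ⇒ P ≠ NP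
(Assembly via SatBridge); X ⇔ NP ⊄ BPP. [sources: JerrumValiantVazirani1986;
doi:10.1006/inco.2000.2885; Goldreich2001FoC1 §2.7.3] -/
@[route_item "route-PneNP-WitnessForging", crux]
def ForgingThesis : Prop :=
  ∀ A : Literature.Computability.Complexity.RandAlg (List Bool) (List Bool), A.IsPolyTime id id → ∃ φ : Literature.Computability.Complexity.CNF ℕ, φ.Satisfiable ∧ φ.numVars ≤ (Literature.Computability.Complexity.encodingCNF.encode φ).length ∧ ∃ E : Set (List Bool), (1 / 4 : ℝ) < |A.pr id (Literature.Computability.Complexity.encodingCNF.encode φ) E - (({y : List Bool | y.length = φ.numVars ∧ φ.eval (fun i => y.getD i false) = true} ∩ E).ncard : ℝ) / ({y : List Bool | y.length = φ.numVars ∧ φ.eval (fun i => y.getD i false) = true}.ncard : ℝ)|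

/-- item stmt-PneNP-2433 · crux · rank 3 · open · by planner
why it might fail: May be FALSE for large d: m is unbounded, so degree-d F₂ maps might realise coordinate-wise algebraic decimation of the clusters; the one printed bound for the class (arXiv:2605.00995) amplifies a marginal gap to non-dyadic 1/3, but μ_Φ's marginals are ≈ ½ (no gap); d = 1 forges shattered XORSAT.
sources: arXiv:2605.00995, doi:10.1137/100814998, doi:10.1007/s00037-009-0258-4, doi:10.1109/focs52979.2021.00038, doi:10.1109/focs.2008.11, doi:10.1007/s00037-012-0039-3
[crux] The XORSAT-immune algebraic rung (new): for every degree d there is k₀ such that for all k ≥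
k₀ and all densities α with 5·2^k·ln k/k ≤ α ≤ 2^{k−1}, for Φ ∼ randomKCNF k n ⌊αn⌋ (tree ensemble
F_k(n,m)): Pr_Φ[Φ satisfiable ∧ ∃ m, ∃ P : F₂^m → F₂^{numVars Φ} with every coordinate an
F₂-polynomial of total degree ≤ d, whose pushforward of the uniform measure on F₂^m is within TV 1/3
of μ_Φ (all events)] → 0 as n → ∞. Degree is in the COINS with Φ hard-wired (non-uniform in Φ),
unlike Bresler–Huang (degree in Φ, search). The window lies inside the Achlioptas–Coja-Oghlan
shattering regime ((1+ε_k)2^k ln k/k, (1−ε_k)2^k ln 2) and below the Achlioptas–Peres satisfiability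
bound, so w.h.p. Φ is satisfiable with exp(Ω(n)) solutions split into exp(Ω(n)) δn-separated
clusters; a proof must use NON-AFFINE rigidity of k-SAT clusters, since affine solution spaces
(XORSAT, also shattered) are forged exactly by degree-1 maps (AffineWitnessesForgeable). Tools: bias
⇒ low rank for F₂-polynomials (quantised local statistics for d ≤ 3), polynomial-source structure
(DGW09), frozen variables. -/
@[route_item "route-PneNP-WitnessForging"]
def LowDegreeRung : Prop :=
  ∀ d : ℕ, ∃ k₀ : ℕ, ∀ k ≥ k₀, ∀ α : ℝ, 5 * 2 ^ k * Real.log k / k ≤ α → 2 * α ≤ 2 ^ k → Filter.Tendsto (fun n : ℕ => ((Literature.Computability.Complexity.randomKCNF k n ⌊α * n⌋₊).toOuterMeasure {φ | φ.Satisfiable ∧ ∃ m : ℕ, ∃ P : Fin φ.numVars → MvPolynomial (Fin m) (ZMod 2), (∀ i, (P i).totalDegree ≤ d) ∧ ∀ E : Set (List Bool), |((Finset.univ.filter fun r : Fin m → Bool => (List.ofFn fun i => decide (MvPolynomial.eval (fun j => if r j then (1 : ZMod 2) else 0) (P i) = 1)) ∈ E).card : ℝ) / 2 ^ m - (({y :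 List Bool | y.length = φ.numVars ∧ φ.eval (fun i => y.getD i false) = true} ∩ E).ncard : ℝ) / ({y : List Bool | y.length = φ.numVars ∧ φ.eval (fun i => y.getD i false) = true}.ncard : ℝ)| ≤ 1 / 3}).toReal) Filter.atTop (nhds 0)

/-- item stmt-PneNP-2434 · crux · rank 4 · open · by planner
why it might fail: Conjecture-strength: one PPT sampler (= search w.p. ≥ 3/4) at some α ≥ 5·2^k ln k/k refutes it; rigorous sampling+counting of random k-SAT rose from 2^{k/3} to 2^k/poly(k) (doi:10.1145/3717823.3718163), search reaches (1−o(1))2^k ln k/k, a factor ≈5 below the window; only OGP-class evidence above.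
sources: doi:10.1145/3717823.3718163, doi:10.1137/1.9781611977554.ch128, doi:10.1109/focs.2008.11, doi:10.1109/focs52979.2021.00038, doi:10.1090/s0894-0347-04-00464-3, doi:10.1109/focs54457.2022.00038
[crux] Thesis strength on the canonical ensemble: there is k₀ such that for all k ≥ k₀, all α with
5·2^k·ln k/k ≤ α ≤ 2^{k−1}, and every PPT A : RandAlg {0,1}* {0,1}*: Pr_{Φ ∼ randomKCNF k n ⌊αn⌋}[Φ
satisfiable ∧ ∀ E, |Pr[A(enc Φ) ∈ E] − μ_Φ(E)| ≤ 1/4] → 0 — no efficient algorithm forges the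
uniform measure on solutions of shattered random k-SAT except on a vanishing fraction of formulas.
The window starts above the search barrier κ*·2^k ln k/k (κ* ≈ 4.91, Bresler–Huang; all known
algorithms stop at ~2^k ln k/k, Achlioptas–Coja-Oghlan), so the item is implied by the standard
conjecture that FINDING solutions there is hard (a sampler is a search algorithm); with
Achlioptas–Peres (Φ satisfiable w.h.p. for α ≤ 2^{k−1}) it implies ForgingThesis (glue filed when
needed). Negative side = kill criterion: an explicit PPT sampler in the window. Known: stable and
MCMC samplers fail on shattered measures (EAMS; El Alaoui–Gamarnik), rigorous samplers reach only α
≈ 2^{k/3} (He–Wu–Yang; Galanis–Goldberg–Guo–Yang; Chen et al.). -/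
@[route_item "route-PneNP-WitnessForging"]
def ShatteredForgingHard : Prop :=
  ∃ k₀ : ℕ, ∀ k ≥ k₀, ∀ α : ℝ, 5 * 2 ^ k * Real.log k / k ≤ α → 2 * α ≤ 2 ^ k → ∀ A : Literature.Computability.Complexity.RandAlg (List Bool) (List Bool), A.IsPolyTime id id → Filter.Tendsto (fun n : ℕ => ((Literature.Computability.Complexity.randomKCNF k n ⌊α * n⌋₊).toOuterMeasure {φ | φ.Satisfiable ∧ ∀ E : Set (List Bool), |A.pr id (Literature.Computability.Complexity.encodingCNF.encode φ) E - (({y : List Bool | y.length = φ.numVars ∧ φ.eval (fun i => y.getD i false) = true} ∩ E).ncard : ℝ) / ({y : List Bool | y.length = φ.numVars ∧ φ.eval (fun i => y.getD i false) = true}.ncard : ℝ)| ≤ 1 / 4}).toReal) Filter.atTop (nhds 0)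

/-- item stmt-PneNP-2432 · support · rank 2 · closed · proved by Summit.PneNP.PneNP.Theorems.satBridge_proof @ 6de9937e1e79 (prover) · by planner
why it might fail: A theorem on paper (JVV86 via Stockmeyer; BGP00); it can fail only AS TYPED: witness length = numVars φ (guarded by numVars ≤ |enc φ|), TV over ALL events with one polynomial coin budget, accuracy 1/(s+1) uniform in φ incl. φ = []; oracle elimination needs error reduction over adaptive queries.
sources: JerrumValiantVazirani1986, book:miklos2019-computational-complexity-counting-sampling Thm 81 (p. 282), Stockmeyer1985, doi:10.1006/inco.2000.2885, Literature.Computability.Complexity.StockMachine.stockmeyerApproxCounting_holds, Literature.Computability.Complexity.exists_randSearch_of_NP_subset_BPP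
[crux] (bridge; rank 2 by plancard policy — the assembly rests on it and it is not yet a tree
theorem) Almost-uniform generation of SAT witnesses from NP ⊆ BPP: if Nondeterministic.NP ⊆ BPP then
for every polynomial s there is a PPT A : RandAlg {0,1}* {0,1}* such that for every satisfiable
compact CNF φ and every event E, |Pr[A(enc φ) ∈ E] − μ_φ(E)| ≤ 1/(s(|enc φ|)+1). On paper:
Jerrum–Valiant–Vazirani (almost-uniform generation ≤ approximate counting for self-reducible
relations; book:miklos2019-computational-complexity-counting-sampling Thm 81, PDF pp. 282–286) +
Stockmeyer approximate counting in FBPP^NP (tree theorem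
Literature.Computability.Complexity.StockMachine.stockmeyerApproxCounting_holds) + oracle
elimination under NP ⊆ BPP with error reduction; or Bellare–Goldreich–Petrank hashing (uniform
generation in PPT^NP) on top of the tree's randomized search exists_randSearch_of_NP_subset_BPP and
AffineHashing. Witness convention: assignments to x_0..x_{numVars−1} (unused low variables are free
uniform bits); restriction of a CNF by a partial assignment stays a CNF (sumcheck #φ = #φ|₀ + #φ|₁,
cf. SumcheckCNF.lean). -/
@[route_item "route-PneNP-WitnessForging", crux]
def SatBridge : Prop :=
  Literature.Computability.Complexity.Nondeterministic.NP ⊆ Literature.Computability.Complexity.BPP → ∀ s : Polynomial ℕ, ∃ A : Literature.Computability.Complexity.RandAlg (List Bool) (List Bool), A.IsPolyTime id id ∧ ∀ φ : Literature.Computability.Complexity.CNF ℕ, φ.Satisfiable → φ.numVars ≤ (Literature.Computability.Complexity.encodingCNF.encode φ).length → ∀ E : Set (List Bool), |A.pr id (Literature.Computability.Complexity.encodingCNF.encode φ) E - (({y : List Bool | y.length = φ.numVars ∧ φ.eval (fun i => y.getD i false) = true} ∩ E).ncard : ℝ) / ({y : List Bool | y.length = φ.numVars ∧ φ.eval (fun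 i => y.getD i false) = true}.ncard : ℝ)| ≤ 1 / (((s.eval (Literature.Computability.Complexity.encodingCNF.encode φ).length : ℕ) : ℝ) + 1)

/-- item stmt-PneNP-10555 · support · rank 9 · closed · proved by Summit.PneNP.PneNP.Theorems.classBridge_proof @ 045c7b513df3 (prover) · by planner
sources: CookClay2006, AroraBarakCC2009, Gill1977, Literature.Computability.Complexity.NP_bool_eq_holds, Literature.Computability.Complexity.P_bool_eq_holds, Literature.Computability.Complexity.P_subset_BPP_holds
[support] Model bridge from Cook's Clay classes (tree `PNPWave0.P/NP Bool`, the ones in the summit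
statement `PneNP`) to the prelude classes the route's machinery lives in: if every Cook-NP language
over {0,1} is Cook-P then `Nondeterministic.NP ⊆ BPP`. Provable now in three lines from the tree
theorems `Literature.Computability.Complexity.NP_bool_eq_holds` (PNPWave0.NP Bool =
Nondeterministic.NP; ClayProblemProofs), `P_bool_eq_holds` (PNPWave0.P Bool = Classes.P;
ClayProblem) and `P_subset_BPP_holds` (Classes.P ⊆ BPP; ProbabilisticClassesProofs): rewrite along
the two equalities, then P ⊆ BPP. Filed as an ITEM (used by the deciding theorem `closes :
ForgingThesis → SatBridge → ClassBridge → PneNP`) so that the route file itself does not import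
`…Complexity.ClayProblem`, whose open conjecture `NPNotSubsetPPoly` was the one unproved fact in the
route's import cone. [deps: none] [difficulty: provable-now] [sources: CookClay2006 §1;
AroraBarakCC2009 Def. 1.13, Def. 2.1, §7.1; Gill1977 Prop. 5.1] -/
@[route_item "route-PneNP-WitnessForging", crux]
def ClassBridge : Prop :=
  Literature.Computability.Complexity.PNPWave0.NP Bool ⊆ Literature.Computability.Complexity.PNPWave0.P Bool → Literature.Computability.Complexity.Nondeterministic.NP ⊆ Literature.Computability.Complexity.BPP

/-- item stmt-PneNP-17539 · support · rank 9 · open · by planner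
sources: AchlioptasPeres2004, doi:10.1090/s0894-0347-04-00464-3, Literature.Computability.Complexity.AchlioptasPeres2004_threshold_lower_bound_holds
[support] Uniformly positive satisfiability of the proper-clause ensemble below 2^{k-1} (known
theorem; provable now from the tree): there is k₁ such that for all k ≥ k₁ and every real α with 2α
≤ 2^k there is ε > 0 with Pr_{Φ ∼ randomKCNF k n ⌊αn⌋}[Φ satisfiable] ≥ ε for all large n (α ≤ 0
gives the empty formula, trivially). Source: Achlioptas–Peres 2004 Thm 2 (r_k ≥ 2^k ln 2 − (k+1) ln
2/2 − 1 − δ_k, δ_k → 0, which exceeds 2^{k−1} for large k), PROVED in the tree for the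
with-replacement literal-array model as
Literature.Computability.Complexity.AchlioptasPeres2004_threshold_lower_bound_holds
(RandomKSatThresholdProofs.lean). Prover work = the model transfer to randomKCNF (k DISTINCT sorted
variables per clause, clauses i.i.d. uniform on kClauses k n): condition the literal array on the
product event 'every clause has k distinct variables' — under it the clause (as a literal set) is
uniform on kClauses k n (k!-to-1), satisfiability is a function of the literal sets, so
Pr_randomKCNF[UNSAT] ≤ Pr_AP[UNSAT] / Pr_AP[all ⌊αn⌋ clauses proper] and Pr_AP[all proper] ≥ (1 −
k²/n)^{⌊αn⌋} → e^{−αk²} > 0 (k, α fixed, n → ∞); hence Pr_randomKCNF[sat] → 1, a fortiori ≥ ε.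
Weakened from 'w.h.p -/
@[route_item "route-PneNP-WitnessForging"]
def WindowSatisfiable : Prop :=
  ∃ k₁ : ℕ, ∀ k ≥ k₁, ∀ α : ℝ, 2 * α ≤ 2 ^ k → ∃ ε : ℝ, 0 < ε ∧ ∀ᶠ n : ℕ in Filter.atTop, ε ≤ ((Literature.Computability.Complexity.randomKCNF k n ⌊α * n⌋₊).toOuterMeasure {φ | φ.Satisfiable}).toReal

/-- item stmt-PneNP-17540 · support · rank 9 · open · by planner
sources: AchlioptasPeres2004, doi:10.1109/focs.2008.11
[support] Glue of the BC2 redirect of the deciding crux (the foreseen item 'ShatteredForgingHard ∧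
AP04 → ForgingThesis' of NOT DECOMPOSED YET): ShatteredForgingHard → WindowSatisfiable →
ForgingThesis. PROOF ATTACHED as evidence (WitnessForgingForgingThesisSplit.lean: lean check rc0, 0
sorries, axioms propext/Classical.choice/Quot.sound; main proof 30 lines + 8 helper lemmas) — a
prover lands it verbatim as `theorem … : ForgingThesisOfPieces := fun hH hS =>
forgingThesis_of_split hH hS`. Argument: fix a PPT A; with k₀ from ShatteredForgingHard and k₁ from
WindowSatisfiable take k = max k₀ k₁ ⊔ 512 and α = 2^k/2, which lies in the window because 10 ln k ≤
k for k ≥ 512 (log x ≤ x − 1 at x = k/40); the mass of {Φ satisfiable ∧ A 1/4-forges μ_Φ} under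
randomKCNF k n ⌊αn⌋ is eventually < ε/2 (Tendsto → 0) while {Φ satisfiable} keeps mass ≥ ε, so by
outer-measure subadditivity the difference has positive mass and meets the support
(PMF.toOuterMeasure_apply_eq_zero_iff); such φ is satisfiable, NOT 1/4-forged by A (push the
negation through ∀ E), and compactly indexed: its variables are < n (support ⊆ lists of kClauses k
n, whose variables are Fin n) and n ≤ ⌊αn⌋ = |φ| ≤ 2|φ| + 2 ≤ |enc -/
@[route_item "route-PneNP-WitnessForging"]
def ForgingThesisOfPieces : Prop :=
  ShatteredForgingHard → WindowSatisfiable → ForgingThesis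

/-- item stmt-PneNP-2435 · support · rank 9 · closed · proved by Summit.PneNP.PneNP.Theorems.localSamplersMissShatteredSets_proof @ db2079850acb (prover) · by planner
sources: doi:10.1137/100814998, doi:10.1109/focs54457.2022.00038, doi:10.1109/focs.2008.11, doi:10.1145/3717823.3718243
[support] The NC⁰ rung, class-free form (provable now; sketch below): for every locality ℓ and δ, ε
> 0 there is n₀ such that for n ≥ n₀, each nonempty S ⊆ {0,1}^n covered by clusters C_1..C_N that
are pairwise δn-separated in Hamming distance and each meet S in ≤ e^{−εn}|S| points, and every
ℓ-local map F : {0,1}^m → {0,1}^n (each output bit reads ≤ ℓ coins; fan-out unbounded), some event E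
has |Pr_r[F(r) ∈ E] − |S ∩ E|/|S|| > 1/3. Sketch: if TV ≤ 1/3 then Pr[F(r) ∈ S] ≥ 2/3; at most ℓ/γ
coins have fan-out ≥ γn (Σ fan-outs ≤ ℓn) — condition on them (≤ 2^{ℓ/γ} branches); in a branch, for
any subfamily J of clusters, g = d(out, ∪_J C) − d(out, ∪_{J^c} C) has Efron–Stein variance ≤ 2γℓn²,
while out ∈ ∪_J C ⇒ g ≤ −δn and out ∈ ∪_{J^c} C ⇒ g ≥ δn, so by Chebyshev min of the two masses ≤ τ
= 2γℓ/δ²; greedy over J ⇒ one cluster carries ≥ (branch mass in S) − 2τ; hence ≤ 2^{ℓ/γ} clusters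
carry ≥ 2/3 − 2τ ≥ 1/2 (γ = δ²/(24ℓ)) while μ gives them ≤ 2^{ℓ/γ}e^{−εn} < 1/6: contradiction.
Discrete twin of the EAMS stability argument; with Achlioptas–Coja-Oghlan shattering it gives the
NC⁰ rung on random k-SAT (glue later). Consistent with XORSAT: shattered, affinely but not locally
forgeable. -/
@[route_item "route-PneNP-WitnessForging"]
def LocalSamplersMissShatteredSets : Prop :=
  ∀ ℓ : ℕ, ∀ δ ε : ℝ, 0 < δ → 0 < ε → ∃ n₀ : ℕ, ∀ n ≥ n₀, ∀ S : Finset (Fin n → Bool), S.Nonempty → ∀ N : ℕ, ∀ C : Fin N → Finset (Fin n → Bool), (∀ x ∈ S, ∃ j, x ∈ C j) → (∀ j j', j ≠ j' → ∀ x ∈ C j, ∀ y ∈ C j', δ * n ≤ (hammingDist x y : ℝ)) → (∀ j, ((C j ∩ S).card : ℝ) ≤ Real.exp (-(ε * n)) * S.card) → ∀ m : ℕ, ∀ F : (Fin m → Bool) → (Fin n → Bool), (∀ i : Fin n, ∃ T : Finset (Fin m), T.card ≤ ℓ ∧ ∀ r r' : Fin m → Bool, (∀ j ∈ T, r j = r'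 j) → F r i = F r' i) → ∃ E : Finset (Fin n → Bool), (1 / 3 : ℝ) < |((Finset.univ.filter fun r : Fin m → Bool => F r ∈ E).card : ℝ) / 2 ^ m - ((S ∩ E).card : ℝ) / S.card|

/-- item stmt-PneNP-2436 · support · rank 9 · closed · proved by Summit.PneNP.PneNP.Theorems.affineWitnessesForgeable_proof @ c26f1f606469 (prover) · by planner
sources: doi:10.1007/s00037-012-0039-3
[support] Sanity floor of the ladder (XORSAT is correctly easy): every nonempty affine subspace V ⊆
F₂^n is forged EXACTLY by a degree-≤1 polynomial map — there are m and affine P : F₂^m → F₂^n whose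
pushforward of the uniform measure equals the uniform measure on V (all event probabilities agree).
Proof: V = v₀ + W, P(r) = v₀ + Σ r_j b_j for a basis (b_j) of W is a bijection F₂^m → V. Shows that
any rung at or above 'affine' (LowDegreeRung, d ≥ 1) must use non-affine structure of k-SAT solution
spaces, and that LocalSamplersMissShatteredSets cannot extend to bounded degree. [sources: folklore;
doi:10.1007/s00037-012-0039-3 (codes ARE hard for AC⁰, i.e. below this floor)] -/
@[route_item "route-PneNP-WitnessForging"]
def AffineWitnessesForgeable : Prop :=
  ∀ n : ℕ, ∀ V : AffineSubspace (ZMod 2) (Fin n → ZMod 2), (V : Set (Fin n → ZMod 2)).Nonempty → ∃ m : ℕ, ∃ P : Fin n → MvPolynomial (Fin m) (ZMod 2), (∀ i, (P i).totalDegree ≤ 1) ∧ ∀ E : Set (Fin n → ZMod 2), ((Finset.univ.filter fun r : Fin m → ZMod 2 => (fun i => MvPolynomial.eval r (P i)) ∈ E).card : ℝ) / 2 ^ m = ((Finset.univ.filter fun v : Fin n → ZMod 2 => v ∈ (V : Set (Fin n → ZMod 2)) ∧ v ∈ E).card : ℝ) / (Finset.univ.filter fun v : Fin n → ZMod 2 =>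 v ∈ (V : Set (Fin n → ZMod 2))).card

/-- item stmt-PneNP-2437 · support · rank 9 · closed · proved by Summit.PneNP.PneNP.Theorems.CalibrationSatBPP_proof @ 44f44e32e03c (prover) · by planner
sources: Goldreich2001FoC1, AroraBarakCC2009, JerrumValiantVazirani1986
[support] Calibration of the thesis from below: SAT ∉ BPP → ForgingThesis. Contrapositive: a PPT A
that 1/4-forges every satisfiable compact φ decides SAT with one-sided error — compact the variable
indices of the input (polynomial-time renaming preserving satisfiability), run A, accept iff the
output satisfies φ: Pr[accept] ≥ μ_φ(Sol) − 1/4 = 3/4 on satisfiable φ and 0 otherwise; so SAT ∈ RP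
⊆ BPP (tree: mem_BPP_iff_randAlg-type facts in ProbabilisticClasses / BPPErrorReduction). With
SatBridge and Cook–Levin (isNPComplete_SAT_holds) this pins X ⇔ NP ⊄ BPP (Ko 1982: NP ⊆ BPP ⇒ NP =
RP). [sources: Goldreich2001FoC1 §2.7.3; AroraBarakCC2009 §7; JerrumValiantVazirani1986] -/
@[route_item "route-PneNP-WitnessForging"]
def CalibrationSatBPP : Prop :=
  Literature.Computability.Complexity.SAT ∉ Literature.Computability.Complexity.BPP → ForgingThesis

-- earlier Assembly (stmt-PneNP-2431, replaced 2026-08-15T16:18:28Z -> stmt-PneNP-10554): retired by None — SatBridge → Literature.Computability.Complexity.P_subset_BPP → Literature.Computability.Complexity.P_bool_eq → Literature.Computability.Complexity.NP_bool_eq → ForgingThesis → PneNP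
/-- item stmt-PneNP-10554 · assembly · rank 1 · closed · proved by Summit.PneNP.PneNP.Theorems.witnessForging_assembly_proof @ 86c75d189fc4 (prover) · by planner
[assembly] X → PneNP for route WitnessForging, restated over listed items only: SatBridge →
ClassBridge → ForgingThesis → PneNP. If ¬PneNP then PNPWave0.NP Bool ⊆ PNPWave0.P Bool; ClassBridge
gives Nondeterministic.NP ⊆ BPP; SatBridge at the constant polynomial s = 3 gives a PPT algorithm
within TV 1/(3+1) = 1/4 of μ_φ on every satisfiable compact φ, contradicting ForgingThesis. PROVED
in the route file as the deciding theorem `closes : ForgingThesis → SatBridge → ClassBridge → PneNP`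
(by_contra; hB (hC hsub) 3; Polynomial.eval_ofNat; linarith; axioms
propext/Classical.choice/Quot.sound) — a prover closes this item with `fun hB hC hX => closes hX hB
hC`. Supersedes the rev-1 signature SatBridge → P_subset_BPP → P_bool_eq → NP_bool_eq →
ForgingThesis → PneNP, whose three middle hypotheses were unlisted Literature facts
(glue.extra-hypothesis) declared in …Complexity.ClayProblem. [sources: folklore;
JerrumValiantVazirani1986; CookClay2006 §1] -/
@[route_item "route-PneNP-WitnessForging"]
def Assembly : Prop :=
  SatBridge → ClassBridge → ForgingThesis → PneNP

/-! D-0027 §2.1 — DECIDING THEOREM (planner-authored via `route open/edit --closes-file`; by planner-rbadge-PneNP-WitnessForging-71e13167-g2-0 2026-08-15T16:18:28Z):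
its hypotheses are this route's items and its conclusion the sub-problem Statement (glue_lint), and it elaborates with this file. -/

@[closes "route-PneNP-WitnessForging"] theorem closes (hX : ForgingThesis) (hB : SatBridge) (hC : ClassBridge) : _root_.PneNP := by
  classical
  by_contra hne
  -- ¬ (P ≠ NP) in Cook's model: every Wave0-NP language is Wave0-P
  have hsub : Literature.Computability.Complexity.PNPWave0.NP Bool ⊆
      Literature.Computability.Complexity.PNPWave0.P Bool := by
    intro L hL
    by_contra hP
    exact hne ⟨L, hL, hP⟩
  -- model bridge (support item): prelude NP ⊆ BPP; SatBridge at the constant polynomial 3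
  obtain ⟨A, hA, hAφ⟩ := hB (hC hsub) 3
  -- the thesis refutes this 1/4-forger
  obtain ⟨φ, hsat, hcomp, E, hE⟩ := hX A hA
  have h4 := hAφ φ hsat hcomp E
  have h3 : (1 : ℝ) / ((((3 : Polynomial ℕ).eval
      (Literature.Computability.Complexity.encodingCNF.encode φ).length : ℕ) : ℝ) + 1) = 1 / 4 := by
    simp only [Polynomial.eval_ofNat]
    norm_num
  rw [h3] at h4
  linarith

end Summit.PneNP.PneNP.Theses.WitnessForging
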